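import Summits.MatrixMultiplication.MatrixMultiplication.Theorems.OutsiderSandwichGenericRank
import HarnessLib

/-!
# The first-order condition at a matrix of maximal rank, determinant-free

Route `OutsiderSandwich` (decomposition cell `decomp-mm`, lens 4 «minimal counterexample /
extremal reduction», gen 28, addendum), support for the aside leaf `BlockOneIsMM`
(stmt-MatrixMultiplication-27147).  The input that lifts the core bound from Dieudonné's
`2n² − 2n` (`OutsiderSandwichLevelRateThree`) to `3n²/2` and the level-`N` rate from
`1 + 2^{-N}` to the LEVEL-INDEPENDENT `5/4` (`OutsiderSandwichLevelRateFour`).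

* `mulVec_mem_range_of_max` — **first-order condition** (the tangent-space lemma behind
  Flanders' theorem): if `X₀` has maximal rank in a subspace `P ≤ M_n(ℂ)`, then every `X ∈ P`
  maps `ker X₀` into `im X₀`.  Proof without determinants: if `X v ∉ im X₀` for some
  `v ∈ ker X₀`, a left inverse of `X₀` on a complement `U` of `ker X₀`, corrected by a functional
  separating `X v` from `im X₀`, turns the kernel equation of `X₀ + tX` on `U ⊕ ℂv` into an
  eigen-equation for one endomorphism of `U`; off its finite spectrum `X₀ + tX` is injective on
  the `(rank X₀ + 1)`-dimensional space `U ⊕ ℂv` — contradicting maximality.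
* `finrank_add_mul_le` — the count: a subspace `P` all of whose elements map `K` into `I` has
  `dim P + dim K · (n − dim I) ≤ n²`.
* `finrank_add_sq_le` — hence `dim P + (n − r)² ≤ n²` for `r` the maximal rank on `P`.

## References
* P. Bürgisser, M. Clausen, M. A. Shokrollahi, *Algebraic Complexity Theory*, Springer (1997),
  §17.1. [BurgisserClausenShokrollahi1997]
* D. Coppersmith, S. Winograd, *Matrix multiplication via arithmetic progressions*,
  J. Symbolic Comput. 9 (1990) 251–280, §7. [CoppersmithWinograd1990]
-/

noncomputable section
open scoped BigOperators Matrix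
set_option linter.dupNamespace false
set_option autoImplicit false

namespace Summit.MatrixMultiplication.MatrixMultiplication.Theorems.OutsiderSandwichFirstOrder

variable {ρ : Type} [Fintype ρ] [DecidableEq ρ]

/-! ## 1. The first-order condition -/

omit [DecidableEq ρ] in
/-- **First-order condition at a maximal-rank element.**  If `X₀ ∈ P` has maximal rank on the
subspace `P`, then `X (ker X₀) ⊆ im X₀` for every `X ∈ P`.
[cite: BurgisserClausenShokrollahi1997, §17.1] -/
theorem mulVec_mem_range_of_max (P : Submodule ℂ (Matrix ρ ρ ℂ)) {X₀ : Matrix ρ ρ ℂ}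
    (hX₀ : X₀ ∈ P) (hmax : ∀ X ∈ P, X.rank ≤ X₀.rank) {X : Matrix ρ ρ ℂ} (hX : X ∈ P)
    {v : ρ → ℂ} (hv : X₀ *ᵥ v = 0) : X *ᵥ v ∈ LinearMap.range X₀.mulVecLin := by
  classical
  by_contra hnot
  -- a functional killing `im X₀` with `ψ (X v) = 1`
  obtain ⟨φ, hφ1, hφ0⟩ := Submodule.exists_dual_map_eq_bot_of_notMem hnot inferInstance
  let ψ : Module.Dual ℂ (ρ → ℂ) := (φ (X *ᵥ v))⁻¹ • φ
  have hψ1 : ψ (X *ᵥ v) = 1 := by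
    show (φ (X *ᵥ v))⁻¹ * φ (X *ᵥ v) = 1
    exact inv_mul_cancel₀ hφ1
  have hψ0 : ∀ u : ρ → ℂ, ψ (X₀ *ᵥ u) = 0 := by
    intro u
    have h0 : φ (X₀ *ᵥ u) = 0 := by
      have hm : φ (X₀ *ᵥ u) ∈ Submodule.map φ (LinearMap.range X₀.mulVecLin) :=
        Submodule.mem_map_of_mem ⟨u, rfl⟩
      rw [hφ0] at hm
      exact (Submodule.mem_bot ℂ).1 hm
    show (φ (X *ᵥ v))⁻¹ * φ (X₀ *ᵥ u) = 0
    rw [h0, mul_zero]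
  -- a left inverse of `X₀` on a complement `U` of `ker X₀`
  obtain ⟨U, hU⟩ := Submodule.exists_isCompl (LinearMap.ker X₀.mulVecLin)
  let f : U →ₗ[ℂ] (ρ → ℂ) := X₀.mulVecLin ∘ₗ U.subtype
  have hf : LinearMap.ker f = ⊥ := by
    rw [eq_bot_iff]
    intro u hu
    rw [LinearMap.mem_ker] at hu
    have h1 : (u : ρ → ℂ) ∈ LinearMap.ker X₀.mulVecLin ⊓ U := ⟨hu, u.2⟩
    rw [hU.inf_eq_bot, Submodule.mem_bot] at h1
    exact (Submodule.mem_bot ℂ).2 (Subtype.ext h1)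
  obtain ⟨ℓ, hℓ⟩ := LinearMap.exists_leftInverse_of_injective f hf
  have hℓu : ∀ u : U, ℓ (X₀ *ᵥ (u : ρ → ℂ)) = u := fun u => LinearMap.ext_iff.1 hℓ u
  -- the corrected endomorphism of `U`
  let b : U →ₗ[ℂ] (ρ → ℂ) := X.mulVecLin ∘ₗ U.subtype
  let C : Module.End ℂ U := ℓ ∘ₗ b - (ψ ∘ₗ b).smulRight (ℓ (X *ᵥ v))
  have hC : ∀ u : U, C u = ℓ (X *ᵥ (u : ρ → ℂ)) - ψ (X *ᵥ (u : ρ → ℂ)) • ℓ (X *ᵥ v) :=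
    fun u => rfl
  have hfin := (Module.End.finite_spectrum C).image fun μ : ℂ => -μ⁻¹
  obtain ⟨t, ht⟩ := Infinite.exists_notMem_finset (insert 0 hfin.toFinset)
  rw [Finset.mem_insert, not_or] at ht
  obtain ⟨ht0, ht⟩ := ht
  have hμ : IsUnit (algebraMap ℂ (Module.End ℂ U) (-t⁻¹) - C) := by
    have h : -t⁻¹ ∉ spectrum ℂ C := by
      intro hmem
      apply ht
      rw [Set.Finite.mem_toFinset]
      refine ⟨-t⁻¹, hmem, ?_⟩
      show -(-t⁻¹)⁻¹ = t
      rw [inv_neg, inv_inv, neg_neg]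
    rwa [spectrum.mem_iff, not_not] at h
  have hbij := (Module.End.isUnit_iff _).1 hμ
  -- `X₀ + tX` is injective on `U ⊕ ℂv`
  let e : (U × ℂ) →ₗ[ℂ] (ρ → ℂ) := U.subtype.coprod (LinearMap.toSpanSingleton ℂ (ρ → ℂ) v)
  let g : (U × ℂ) →ₗ[ℂ] (ρ → ℂ) := (X₀ + t • X).mulVecLin ∘ₗ e
  have hg : ∀ p : U × ℂ, g p = X₀ *ᵥ (p.1 : ρ → ℂ) + t • X *ᵥ (p.1 : ρ → ℂ) +
      (t * p.2) • X *ᵥ v := by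
    intro p
    show (X₀ + t • X) *ᵥ ((p.1 : ρ → ℂ) + p.2 • v) = _
    rw [Matrix.add_mulVec, Matrix.smul_mulVec, Matrix.mulVec_add, Matrix.mulVec_add,
      Matrix.mulVec_smul, Matrix.mulVec_smul, hv, smul_zero, add_zero, smul_add, smul_smul,
      add_assoc]
  have hinj : Function.Injective g := by
    rw [← LinearMap.ker_eq_bot, eq_bot_iff]
    intro p hp
    rw [LinearMap.mem_ker, hg] at hp
    -- apply `ψ`: `p.2 = -ψ (X p.1)`
    have h2 : p.2 = -ψ (X *ᵥ (p.1 : ρ → ℂ)) := by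
      have e1 := congrArg ψ hp
      rw [map_add, map_add, map_smul, map_smul, hψ0, hψ1, map_zero, zero_add, smul_eq_mul,
        smul_eq_mul, mul_one, ← mul_add, mul_eq_zero] at e1
      rcases e1 with e1 | e1
      · exact absurd e1 ht0
      · exact eq_neg_of_add_eq_zero_right e1
    -- apply `ℓ`: `p.1 + t • C p.1 = 0`
    have h1 : p.1 + t • C p.1 = 0 := by
      have e1 := congrArg ℓ hp
      rw [map_add, map_add, map_smul, map_smul, hℓu, map_zero, h2] at e1
      have e2 : p.1 + t • C p.1 =
          p.1 + t • ℓ (X *ᵥ (p.1 : ρ → ℂ)) + (t * -ψ (X *ᵥ (p.1 : ρ → ℂ))) • ℓ (X *ᵥ v) := by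
        rw [hC]
        module
      rw [e2]
      exact e1
    have hCw : C p.1 = (-t⁻¹) • p.1 := by
      have e1 : t • C p.1 = -p.1 := eq_neg_of_add_eq_zero_right h1
      have e2 : C p.1 = t⁻¹ • (t • C p.1) := by
        rw [smul_smul, inv_mul_cancel₀ ht0, one_smul]
      rw [e2, e1, smul_neg]
      exact (neg_smul t⁻¹ p.1).symm
    have hz : (algebraMap ℂ (Module.End ℂ U) (-t⁻¹) - C) p.1 = 0 := by
      rw [LinearMap.sub_apply, Module.algebraMap_end_apply, hCw, sub_self]
    have hp1 : p.1 = 0 := hbij.1 (by rw [hz, map_zero])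
    have hp2 : p.2 = 0 := by rw [h2, hp1]; simp
    exact (Submodule.mem_bot ℂ).2 (Prod.ext hp1 hp2)
  -- dimension count: `dim U + 1 ≤ rank (X₀ + tX) ≤ rank X₀ = dim U`
  have h1 := LinearMap.finrank_range_of_inj hinj
  rw [Module.finrank_prod, Module.finrank_self] at h1
  have h2 : Module.finrank ℂ (LinearMap.range g) ≤ (X₀ + t • X).rank :=
    Submodule.finrank_mono (LinearMap.range_comp_le_range _ _)
  have h3 := hmax (X₀ + t • X) (P.add_mem hX₀ (P.smul_mem t hX))
  have h4 := Submodule.finrank_add_eq_of_isCompl hU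
  have h5 := LinearMap.finrank_range_add_finrank_ker X₀.mulVecLin
  rw [Module.finrank_fintype_fun_eq_card] at h4 h5
  unfold Matrix.rank at h2 h3
  omega

/-! ## 2. The count -/

/-- **The count.**  If every element of `P` maps `K` into `I`, then
`dim P + dim K · (n − dim I) ≤ n²`. [cite: BurgisserClausenShokrollahi1997, §17.1] -/
theorem finrank_add_mul_le (P : Submodule ℂ (Matrix ρ ρ ℂ)) (K I : Submodule ℂ (ρ → ℂ))
    (hP : ∀ X ∈ P, ∀ v ∈ K, X *ᵥ v ∈ I) :
    Module.finrank ℂ P + Module.finrank ℂ K * (Fintype.card ρ - Module.finrank ℂ I) ≤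
      Fintype.card ρ ^ 2 := by
  classical
  obtain ⟨I', hI⟩ := Submodule.exists_isCompl I
  obtain ⟨K', hK⟩ := Submodule.exists_isCompl K
  let π : (ρ → ℂ) →ₗ[ℂ] I' := Submodule.projectionOnto I' I hI.symm
  let πK : (ρ → ℂ) →ₗ[ℂ] K := Submodule.projectionOnto K K' hK
  let bK := Module.finBasis ℂ K
  let Φ : Matrix ρ ρ ℂ →ₗ[ℂ] (Fin (Module.finrank ℂ K) → I') :=
    LinearMap.pi fun i => π ∘ₗ (LinearMap.applyₗ (bK i : ρ → ℂ)) ∘ₗ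
      (Matrix.toLin' : Matrix ρ ρ ℂ ≃ₗ[ℂ] ((ρ → ℂ) →ₗ[ℂ] (ρ → ℂ))).toLinearMap
  have hΦ : ∀ (X : Matrix ρ ρ ℂ) (i : Fin (Module.finrank ℂ K)),
      Φ X i = π (X *ᵥ (bK i : ρ → ℂ)) := fun X i => by
    show π (Matrix.toLin' X (bK i : ρ → ℂ)) = _
    rw [Matrix.toLin'_apply]
  -- `P ≤ ker Φ`
  have hPker : P ≤ LinearMap.ker Φ := by
    intro X hX
    rw [LinearMap.mem_ker]
    funext i
    rw [hΦ, Pi.zero_apply, Submodule.projectionOnto_apply_eq_zero_iff]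
    exact hP X hX _ (bK i).2
  -- `Φ` is surjective
  have hsurj : LinearMap.range Φ = ⊤ := by
    rw [LinearMap.range_eq_top]
    intro g
    refine ⟨LinearMap.toMatrix' (I'.subtype ∘ₗ (bK.constr ℂ g) ∘ₗ πK), ?_⟩
    funext i
    rw [hΦ, LinearMap.toMatrix'_mulVec, LinearMap.comp_apply, LinearMap.comp_apply,
      Submodule.projectionOnto_apply_left, Module.Basis.constr_basis, Submodule.subtype_apply,
      Submodule.projectionOnto_apply_left]
  -- the count
  have hM : Module.finrank ℂ (Matrix ρ ρ ℂ) = Fintype.card ρ ^ 2 := by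
    rw [Module.finrank_matrix, Module.finrank_self, mul_one, sq]
  have h1 := LinearMap.finrank_range_add_finrank_ker Φ
  have hpi : Module.finrank ℂ (Fin (Module.finrank ℂ K) → I') =
      Module.finrank ℂ K * Module.finrank ℂ I' := by
    rw [Module.finrank_pi_fintype ℂ, Finset.sum_const, Finset.card_univ, Fintype.card_fin,
      smul_eq_mul]
  rw [hsurj, finrank_top, hpi, hM] at h1
  have h2 := Submodule.finrank_mono hPker
  have h3 := Submodule.finrank_add_eq_of_isCompl hI
  rw [Module.finrank_fintype_fun_eq_card] at h3
  have h4 : Module.finrank ℂ I' = Fintype.card ρ - Module.finrank ℂ I := by omega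
  rw [← h4]
  omega

omit [DecidableEq ρ] in
/-- **`dim P + (n − r)² ≤ n²`** for `r` the maximal rank on `P`.
[cite: BurgisserClausenShokrollahi1997, §17.1] -/
theorem finrank_add_sq_le (P : Submodule ℂ (Matrix ρ ρ ℂ)) {X₀ : Matrix ρ ρ ℂ} (hX₀ : X₀ ∈ P)
    (hmax : ∀ X ∈ P, X.rank ≤ X₀.rank) :
    Module.finrank ℂ P + (Fintype.card ρ - X₀.rank) ^ 2 ≤ Fintype.card ρ ^ 2 := by
  classical
  have h := finrank_add_mul_le P (LinearMap.ker X₀.mulVecLin) (LinearMap.range X₀.mulVecLin)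
    fun X hX v hv => mulVec_mem_range_of_max P hX₀ hmax hX (LinearMap.mem_ker.1 hv)
  have h5 := LinearMap.finrank_range_add_finrank_ker X₀.mulVecLin
  rw [Module.finrank_fintype_fun_eq_card] at h5
  have hk : Module.finrank ℂ (LinearMap.ker X₀.mulVecLin) = Fintype.card ρ - X₀.rank := by
    unfold Matrix.rank; omega
  rw [hk] at h
  unfold Matrix.rank at h ⊢
  rw [sq (Fintype.card ρ - _)]
  exact h

end Summit.MatrixMultiplication.MatrixMultiplication.Theorems.OutsiderSandwichFirstOrder
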